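import Mathlib
import Summits.HodgeConjecture.HodgeConjecture.Theses.TropicalWeilObstruction

/-!
# Route `TropicalWeilObstruction` — support item `GenericWeilPeriod` (stmt-HodgeConjecture-18481)

There is a positive definite real `8 × 8` matrix `Q` commuting with the complex structure
`J = weilJ 4` (`J e_k = e_{k+4}`, `J e_{k+4} = -e_k`) whose 16 free entries (`weilFreeIndex 4`: the
upper triangle of the symmetric block `A`, diagonal included, and the strict upper triangle of the
antisymmetric block `B` of `Q = [[A, B], [-B, A]]`) are algebraically independent over `ℚ` — a
"very general" member of Zharkov's tropical Weil family.

Proof (transcendence degree + perturbation of the identity):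
* a transcendence basis of `ℝ/ℚ` is infinite (`ℝ` is uncountable, an algebraic extension of a
  countable ring is countable), so there are 16 algebraically independent reals `x_k`;
* affine substitutions `x_k ↦ q_k x_k + c_k` (`q_k, c_k ∈ ℚ`, `q_k ≠ 0`) preserve algebraic
  independence (they are automorphisms of `ℚ[X_k]`), so we may rescale to `|y_k| ≤ 1/16` and add `1`
  on the diagonal;
* `Q = 1 + E`, `E = [[A₀, B], [-B, A₀]]` symmetric with `J E = E J` (block identity) and all
  `|E_ab| ≤ 1/16`, is symmetric, commutes with `J`, and `xᵀ Q x ≥ ‖x‖² - (1/16)(Σ|x_a|)² ≥ ‖x‖²/2 > 0`.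
No definition, no named-fact hypothesis, no sorry.
-/

set_option linter.dupNamespace false

noncomputable section

open scoped BigOperators Matrix
open Cardinal Matrix Literature.AlgebraicGeometry.Tropical

namespace Summit.HodgeConjecture.HodgeConjecture.Theorems

namespace GenericWeilPeriod

/-! ### Algebraically independent reals -/

/-- Affine changes of variables with rational coefficients preserve algebraic independence over `ℚ`:
if `x` is algebraically independent and `q i ≠ 0`, so is `i ↦ q i * x i + c i`. -/
theorem algebraicIndependent_affine {ι : Type*} {x : ι → ℝ} (hx : AlgebraicIndependent ℚ x)
    (q c : ι → ℚ) (hq : ∀ i, q i ≠ 0) :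
    AlgebraicIndependent ℚ fun i => (q i : ℝ) * x i + c i := by
  classical
  -- the affine substitution `X i ↦ q i • X i + c i` and its inverse
  let f : ι → MvPolynomial ι ℚ := fun i => MvPolynomial.C (q i) * MvPolynomial.X i + MvPolynomial.C (c i)
  let g : ι → MvPolynomial ι ℚ := fun i =>
    MvPolynomial.C (q i)⁻¹ * (MvPolynomial.X i - MvPolynomial.C (c i))
  have hgf : (MvPolynomial.aeval g).comp (MvPolynomial.aeval f) = AlgHom.id ℚ _ := by
    refine MvPolynomial.algHom_ext fun i => ?_
    simp only [AlgHom.comp_apply, MvPolynomial.aeval_X, AlgHom.id_apply, f, g, map_add, map_mul,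
      MvPolynomial.aeval_C, MvPolynomial.algebraMap_eq]
    have hqi : MvPolynomial.C (σ := ι) (q i) * MvPolynomial.C (q i)⁻¹ = 1 := by
      rw [← MvPolynomial.C_mul, mul_inv_cancel₀ (hq i), MvPolynomial.C_1]
    linear_combination (MvPolynomial.X i - MvPolynomial.C (c i)) * hqi
  have hinj : Function.Injective (MvPolynomial.aeval (R := ℚ) f) := by
    intro a b hab
    have := congrArg (MvPolynomial.aeval g) hab
    rwa [← AlgHom.comp_apply, ← AlgHom.comp_apply, hgf, AlgHom.id_apply, AlgHom.id_apply] at this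
  have hf : AlgebraicIndependent ℚ f := by
    have h := (MvPolynomial.algebraicIndependent_X ι ℚ).map' hinj
    convert h using 1
    funext i
    simp [f]
  have key := hx.aeval_of_algebraicIndependent hf
  convert key using 1
  funext i
  simp [f]

/-- A transcendence basis of `ℝ` over `ℚ` is infinite (`ℝ` is uncountable, while an algebraic
extension of the countable ring `ℚ[x_1, …, x_n]` is countable). -/
theorem infinite_of_isTranscendenceBasis_real {ι : Type} {v : ι → ℝ}
    (hv : IsTranscendenceBasis ℚ v) : Infinite ι := by
  by_contra hfin
  rw [not_infinite_iff_finite] at hfin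
  haveI := hv.isAlgebraic
  have h1 : #ℝ ≤ max #(Algebra.adjoin ℚ (Set.range v)) ℵ₀ :=
    Algebra.IsAlgebraic.cardinalMk_le_max (Algebra.adjoin ℚ (Set.range v)) ℝ
  have h2 : #(Algebra.adjoin ℚ (Set.range v)) = #(MvPolynomial ι ℚ) :=
    (Cardinal.mk_congr hv.1.aevalEquiv.toEquiv).symm
  have h3 : #(MvPolynomial ι ℚ) ≤ ℵ₀ :=
    MvPolynomial.cardinalMk_le_max.trans
      (max_le (max_le Cardinal.mkRat.le (Cardinal.lt_aleph0_of_finite ι).le) le_rfl)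
  have : #ℝ ≤ ℵ₀ := h1.trans (max_le (h2 ▸ h3) le_rfl)
  rw [Cardinal.mk_real] at this
  exact absurd this (not_le_of_gt Cardinal.aleph0_lt_continuum)

/-- Every finite type indexes an algebraically independent family of real numbers. -/
theorem exists_algebraicIndependent_real (ι : Type) [Finite ι] :
    ∃ x : ι → ℝ, AlgebraicIndependent ℚ x := by
  obtain ⟨s, hs⟩ := exists_isTranscendenceBasis ℚ ℝ
  haveI : Infinite s := infinite_of_isTranscendenceBasis_real hs
  let e : ι ↪ s :=
    (Finite.equivFin ι).toEmbedding.trans (Fin.valEmbedding.trans (Infinite.natEmbedding s))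
  exact ⟨fun i => (e i : ℝ), hs.1.comp e e.injective⟩

/-- … with all members of absolute value at most `δ > 0` (rescale by small non-zero rationals). -/
theorem exists_algebraicIndependent_real_small (ι : Type) [Finite ι] {δ : ℝ} (hδ : 0 < δ) :
    ∃ x : ι → ℝ, AlgebraicIndependent ℚ x ∧ ∀ i, |x i| ≤ δ := by
  obtain ⟨x, hx⟩ := exists_algebraicIndependent_real ι
  -- a rational `r` with `0 < r < δ`, and the scalings `q i = r / (⌈|x i|⌉₊ + 1)`
  obtain ⟨r, hr0, hrδ⟩ := exists_rat_btwn hδ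
  have hr0' : (0 : ℚ) < r := by exact_mod_cast hr0
  let q : ι → ℚ := fun i => r / ((⌈|x i|⌉₊ : ℚ) + 1)
  have hq : ∀ i, q i ≠ 0 := fun i => by
    have : (0 : ℚ) < (⌈|x i|⌉₊ : ℚ) + 1 := by positivity
    exact (div_pos hr0' this).ne'
  refine ⟨fun i => (q i : ℝ) * x i + ((0 : ℚ) : ℝ), algebraicIndependent_affine hx q (fun _ => 0) hq,
    fun i => ?_⟩
  have hN : |x i| ≤ (⌈|x i|⌉₊ : ℝ) + 1 :=
    (Nat.le_ceil _).trans (le_add_of_nonneg_right zero_le_one)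
  have hN0 : (0 : ℝ) < (⌈|x i|⌉₊ : ℝ) + 1 := by positivity
  have hqi : ((q i : ℚ) : ℝ) = (r : ℝ) / ((⌈|x i|⌉₊ : ℝ) + 1) := by
    simp [q]
  show |((q i : ℚ) : ℝ) * x i + ((0 : ℚ) : ℝ)| ≤ δ
  rw [Rat.cast_zero, add_zero, abs_mul, hqi, abs_of_pos (div_pos hr0 hN0), div_mul_eq_mul_div,
    div_le_iff₀ hN0]
  calc (r : ℝ) * |x i| ≤ r * ((⌈|x i|⌉₊ : ℝ) + 1) := by gcongr
    _ ≤ δ * ((⌈|x i|⌉₊ : ℝ) + 1) := by gcongr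

/-! ### Block matrices `[[A, B], [-B, A]]` on `Fin 8 = Fin 4 ⊕ Fin 4` and `J` -/

/-- `J = weilJ 4` in block form `[[0, -1], [1, 0]]` on `Fin 4 ⊕ Fin 4`. -/
theorem weilJ_four_eq :
    (weilJ 4 : Matrix (Fin 8) (Fin 8) ℝ) =
      Matrix.reindex (finSumFinEquiv (m := 4) (n := 4)) (finSumFinEquiv (m := 4) (n := 4))
        (Matrix.fromBlocks (0 : Matrix (Fin 4) (Fin 4) ℝ) (-1) 1 0) := by
  ext a b
  obtain ⟨u, rfl⟩ := (finSumFinEquiv (m := 4) (n := 4)).surjective a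
  obtain ⟨v, rfl⟩ := (finSumFinEquiv (m := 4) (n := 4)).surjective b
  simp only [Matrix.reindex_apply, Matrix.submatrix_apply, Equiv.symm_apply_apply, weilJ]
  rcases u with i | i <;> rcases v with j | j
  all_goals
    have hi := i.isLt
    have hj := j.isLt
    simp only [finSumFinEquiv_apply_left, finSumFinEquiv_apply_right, Fin.val_castAdd,
      Fin.val_natAdd, Matrix.fromBlocks_apply₁₁, Matrix.fromBlocks_apply₁₂,
      Matrix.fromBlocks_apply₂₁, Matrix.fromBlocks_apply₂₂, Matrix.zero_apply, Matrix.neg_apply,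
      Matrix.one_apply, Fin.ext_iff]
    split_ifs <;> first | rfl | (exfalso; omega) | simp

/-- Block matrices `[[A, B], [-B, A]]` commute with `J`. -/
theorem blocks_mul_weilJ (A B : Matrix (Fin 4) (Fin 4) ℝ) :
    Matrix.reindex (finSumFinEquiv (m := 4) (n := 4)) (finSumFinEquiv (m := 4) (n := 4))
        (Matrix.fromBlocks A B (-B) A) * (weilJ 4 : Matrix (Fin 8) (Fin 8) ℝ) =
      (weilJ 4 : Matrix (Fin 8) (Fin 8) ℝ) *
        Matrix.reindex (finSumFinEquiv (m := 4) (n := 4)) (finSumFinEquiv (m := 4) (n := 4))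
          (Matrix.fromBlocks A B (-B) A) := by
  rw [weilJ_four_eq, Matrix.reindex_apply, Matrix.reindex_apply, Matrix.submatrix_mul_equiv,
    Matrix.submatrix_mul_equiv, Matrix.fromBlocks_multiply, Matrix.fromBlocks_multiply]
  simp

/-- `[[A, B], [-B, A]]` is symmetric when `Aᵀ = A` and `Bᵀ = -B`. -/
theorem blocks_transpose (A B : Matrix (Fin 4) (Fin 4) ℝ) (hA : Aᵀ = A) (hB : Bᵀ = -B) :
    (Matrix.reindex (finSumFinEquiv (m := 4) (n := 4)) (finSumFinEquiv (m := 4) (n := 4))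
        (Matrix.fromBlocks A B (-B) A))ᵀ =
      Matrix.reindex (finSumFinEquiv (m := 4) (n := 4)) (finSumFinEquiv (m := 4) (n := 4))
        (Matrix.fromBlocks A B (-B) A) := by
  rw [Matrix.transpose_reindex, Matrix.fromBlocks_transpose, hA, Matrix.transpose_neg, hB, neg_neg]

/-- Entries of `[[A, B], [-B, A]]` are bounded by a common bound of the entries of `A` and `B`. -/
theorem abs_blocks_apply_le (A B : Matrix (Fin 4) (Fin 4) ℝ) {δ : ℝ} (hA : ∀ i j, |A i j| ≤ δ)
    (hB : ∀ i j, |B i j| ≤ δ) (a b : Fin 8) :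
    |Matrix.reindex (finSumFinEquiv (m := 4) (n := 4)) (finSumFinEquiv (m := 4) (n := 4))
        (Matrix.fromBlocks A B (-B) A) a b| ≤ δ := by
  simp only [Matrix.reindex_apply, Matrix.submatrix_apply]
  rcases (finSumFinEquiv (m := 4) (n := 4)).symm a with i | i <;>
    rcases (finSumFinEquiv (m := 4) (n := 4)).symm b with j | j
  · simpa using hA i j
  · simpa using hB i j
  · simpa [abs_neg] using hB i j
  · simpa using hA i j

/-! ### Positivity of a small symmetric perturbation of the identity -/

/-- If `E` is a symmetric real `8 × 8` matrix with `|E_ab| ≤ 1/16`, then `1 + E` is positive definite: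
`xᵀ(1 + E)x ≥ Σ x_a² - (1/16)(Σ |x_a|)² ≥ Σ x_a² / 2`. -/
theorem posDef_one_add {E : Matrix (Fin 8) (Fin 8) ℝ} (hsymm : Eᵀ = E)
    (hE : ∀ a b, |E a b| ≤ 1 / 16) : (1 + E).PosDef := by
  refine Matrix.PosDef.of_dotProduct_mulVec_pos ?_ fun x hx => ?_
  · rw [Matrix.IsHermitian, Matrix.conjTranspose_eq_transpose_of_trivial, Matrix.transpose_add,
      Matrix.transpose_one, hsymm]
  · have hquad : dotProduct (star x) ((1 + E) *ᵥ x) = ∑ a, x a ^ 2 + ∑ a, ∑ b, E a b * (x a * x b) := by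
      rw [star_trivial, Matrix.add_mulVec, Matrix.one_mulVec, dotProduct_add]
      congr 1
      · simp [dotProduct, sq]
      · simp only [dotProduct, Matrix.mulVec, Finset.mul_sum]
        exact Finset.sum_congr rfl fun a _ => Finset.sum_congr rfl fun b _ => by ring
    have hbound : |∑ a, ∑ b, E a b * (x a * x b)| ≤ (1 / 16) * (∑ a, |x a|) ^ 2 := by
      calc |∑ a, ∑ b, E a b * (x a * x b)|
          ≤ ∑ a, |∑ b, E a b * (x a * x b)| := Finset.abs_sum_le_sum_abs _ _
        _ ≤ ∑ a, ∑ b, |E a b * (x a * x b)| :=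
            Finset.sum_le_sum fun a _ => Finset.abs_sum_le_sum_abs _ _
        _ ≤ ∑ a, ∑ b, (1 / 16) * (|x a| * |x b|) :=
            Finset.sum_le_sum fun a _ => Finset.sum_le_sum fun b _ => by
              rw [abs_mul, abs_mul]
              exact mul_le_mul_of_nonneg_right (hE a b) (by positivity)
        _ = (1 / 16) * (∑ a, |x a|) ^ 2 := by
            rw [sq, Finset.sum_mul_sum, Finset.mul_sum]
            exact Finset.sum_congr rfl fun a _ => by rw [Finset.mul_sum]
    have hcs : (∑ a, |x a|) ^ 2 ≤ 8 * ∑ a, x a ^ 2 := by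
      have h := sq_sum_le_card_mul_sum_sq (s := (Finset.univ : Finset (Fin 8))) (f := fun a => |x a|)
      simp only [Finset.card_univ, Fintype.card_fin, Nat.cast_ofNat, sq_abs] at h
      exact h
    have hpos : 0 < ∑ a, x a ^ 2 := by
      obtain ⟨a, ha⟩ : ∃ a, x a ≠ 0 := Function.ne_iff.mp hx
      exact Finset.sum_pos' (fun b _ => sq_nonneg (x b)) ⟨a, Finset.mem_univ a, by positivity⟩
    rw [hquad]
    have := neg_le_of_abs_le hbound
    nlinarith

/-! ### The witness -/

/-- For every assignment `y` of the 16 free coordinates with `|y_k| ≤ 1/16` there is a symmetric `E`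
with `|E_ab| ≤ 1/16`, `E J = J E`, and free entries of `1 + E` equal to `y_{(a,b)} + 1_{a = b}`:
`E = [[A₀, B], [-B, A₀]]`, `A₀` symmetric with upper triangle `y_{(i,j)}`, `B` antisymmetric with
strict upper triangle `y_{(i, j+4)}`. -/
theorem exists_perturbation (y : weilFreeIndex 4 → ℝ) (hy : ∀ k, |y k| ≤ 1 / 16) :
    ∃ E : Matrix (Fin 8) (Fin 8) ℝ, Eᵀ = E ∧ (∀ a b, |E a b| ≤ 1 / 16) ∧
      E * (weilJ 4 : Matrix (Fin 8) (Fin 8) ℝ) = (weilJ 4 : Matrix (Fin 8) (Fin 8) ℝ) * E ∧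
      ∀ ab : weilFreeIndex 4, (1 + E) ab.1.1 ab.1.2 =
        ((1 : ℚ) : ℝ) * y ab + ((if ab.1.1 = ab.1.2 then 1 else 0 : ℚ) : ℝ) := by
  -- total extension of `y` by zero to all pairs of naturals
  obtain ⟨z, hz, hzb⟩ : ∃ z : ℕ → ℕ → ℝ,
      (∀ ab : weilFreeIndex 4, z ab.1.1 ab.1.2 = y ab) ∧ ∀ a b, |z a b| ≤ 1 / 16 := by
    classical
    refine ⟨fun a b => if h : a < 2 * 4 ∧ b < 2 * 4 ∧ (a ≤ b ∧ (b < 4 ∨ (a < 4 ∧ a + 4 < b))) then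
        y ⟨(⟨a, h.1⟩, ⟨b, h.2.1⟩), h.2.2⟩ else 0, fun ab => ?_, fun a b => ?_⟩
    · obtain ⟨⟨a, b⟩, hab⟩ := ab
      have h : (a : ℕ) < 2 * 4 ∧ (b : ℕ) < 2 * 4 ∧
          ((a : ℕ) ≤ b ∧ ((b : ℕ) < 4 ∨ ((a : ℕ) < 4 ∧ (a : ℕ) + 4 < b))) := ⟨a.2, b.2, hab⟩
      simp only [dif_pos h]
    · simp only
      split_ifs
      · exact hy _
      · norm_num
  -- the blocks
  obtain ⟨A, hA⟩ : ∃ A : Matrix (Fin 4) (Fin 4) ℝ,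
      A = Matrix.of fun i j : Fin 4 => if (i : ℕ) ≤ j then z i j else z j i := ⟨_, rfl⟩
  obtain ⟨B, hB⟩ : ∃ B : Matrix (Fin 4) (Fin 4) ℝ, B = Matrix.of fun i j : Fin 4 =>
      if (i : ℕ) < j then z i (j + 4) else if (j : ℕ) < i then -z j (i + 4) else 0 := ⟨_, rfl⟩
  have hAt : Aᵀ = A := by
    ext i j
    simp only [hA, Matrix.transpose_apply, Matrix.of_apply]
    rcases lt_trichotomy (i : ℕ) j with h | h | h
    · rw [if_neg (not_le_of_gt h), if_pos h.le]
    · simp [h]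
    · rw [if_pos h.le, if_neg (not_le_of_gt h)]
  have hBt : Bᵀ = -B := by
    ext i j
    simp only [hB, Matrix.transpose_apply, Matrix.of_apply, Matrix.neg_apply]
    rcases lt_trichotomy (i : ℕ) j with h | h | h
    · rw [if_neg (lt_asymm h), if_pos h, if_pos h]
    · simp [h]
    · rw [if_pos h, if_neg (lt_asymm h), if_pos h, neg_neg]
  have hAb : ∀ i j, |A i j| ≤ 1 / 16 := fun i j => by
    simp only [hA, Matrix.of_apply]
    split_ifs <;> exact hzb _ _
  have hBb : ∀ i j, |B i j| ≤ 1 / 16 := fun i j => by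
    simp only [hB, Matrix.of_apply]
    split_ifs
    · exact hzb _ _
    · rw [abs_neg]; exact hzb _ _
    · norm_num
  refine ⟨Matrix.reindex (finSumFinEquiv (m := 4) (n := 4)) (finSumFinEquiv (m := 4) (n := 4))
      (Matrix.fromBlocks A B (-B) A), blocks_transpose A B hAt hBt, abs_blocks_apply_le A B hAb hBb,
    blocks_mul_weilJ A B, fun ab => ?_⟩
  -- the free entries
  obtain ⟨⟨a, b⟩, hab⟩ := ab
  have hfree : (a : ℕ) ≤ b ∧ ((b : ℕ) < 4 ∨ ((a : ℕ) < 4 ∧ (a : ℕ) + 4 < b)) := hab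
  have hz' : z a b = y ⟨(a, b), hab⟩ := hz ⟨(a, b), hab⟩
  show (1 + Matrix.reindex (finSumFinEquiv (m := 4) (n := 4)) (finSumFinEquiv (m := 4) (n := 4))
      (Matrix.fromBlocks A B (-B) A)) a b =
    ((1 : ℚ) : ℝ) * y ⟨(a, b), hab⟩ + ((if a = b then 1 else 0 : ℚ) : ℝ)
  rw [Matrix.add_apply, Matrix.one_apply, Rat.cast_one, one_mul, add_comm, ← hz']
  congr 1
  · simp only [Matrix.reindex_apply, Matrix.submatrix_apply]
    have ha4 : (a : ℕ) < 4 := by omega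
    have hsa : (finSumFinEquiv (m := 4) (n := 4)).symm a = Sum.inl (⟨a, ha4⟩ : Fin 4) := by
      have : a = Fin.castAdd 4 (⟨a, ha4⟩ : Fin 4) := Fin.ext rfl
      conv_lhs => rw [this]
      exact finSumFinEquiv_symm_apply_castAdd _
    rcases hfree.2 with hb4 | ⟨-, hb5⟩
    · have hsb : (finSumFinEquiv (m := 4) (n := 4)).symm b = Sum.inl (⟨b, hb4⟩ : Fin 4) := by
        have : b = Fin.castAdd 4 (⟨b, hb4⟩ : Fin 4) := Fin.ext rfl
        conv_lhs => rw [this]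
        exact finSumFinEquiv_symm_apply_castAdd _
      rw [hsa, hsb, Matrix.fromBlocks_apply₁₁]
      simp only [hA, Matrix.of_apply]
      rw [if_pos hfree.1]
    · have hb4 : (b : ℕ) - 4 < 4 := by omega
      have hsb : (finSumFinEquiv (m := 4) (n := 4)).symm b =
          Sum.inr (⟨(b : ℕ) - 4, hb4⟩ : Fin 4) := by
        have : b = Fin.natAdd 4 (⟨(b : ℕ) - 4, hb4⟩ : Fin 4) :=
          Fin.ext (by simp only [Fin.val_natAdd]; omega)
        conv_lhs => rw [this]
        exact finSumFinEquiv_symm_apply_natAdd _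
      rw [hsa, hsb, Matrix.fromBlocks_apply₁₂]
      simp only [hB, Matrix.of_apply]
      rw [if_pos (show (a : ℕ) < (b : ℕ) - 4 by omega),
        show (b : ℕ) - 4 + 4 = (b : ℕ) by omega]
  · split_ifs <;> simp

end GenericWeilPeriod

open GenericWeilPeriod in
/-- **Item stmt-HodgeConjecture-18481 (`GenericWeilPeriod`, route `TropicalWeilObstruction`)**: there is
a positive definite real `8 × 8` matrix `Q` with `Q J = J Q` (`J = weilJ 4`) whose 16 free entries
`weilFreeIndex 4` are algebraically independent over `ℚ`.  Witness: `Q = 1 + E`,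
`E = [[A₀, B], [-B, A₀]]` filled with a rescaled algebraically independent family of absolute value
`≤ 1/16` (transcendence bases of `ℝ/ℚ` are infinite; affine rational substitutions preserve
algebraic independence; `xᵀQx ≥ ‖x‖²/2`).  The type is literally the route decl
`Summit.HodgeConjecture.HodgeConjecture.Theses.TropicalWeilObstruction.GenericWeilPeriod`.
[cite: Zharkov2020TropicalWeil, §2 (pp. 2–4)] -/
theorem tropicalWeilObstruction_genericWeilPeriod_proof :
    Summit.HodgeConjecture.HodgeConjecture.Theses.TropicalWeilObstruction.GenericWeilPeriod := by
  unfold Summit.HodgeConjecture.HodgeConjecture.Theses.TropicalWeilObstruction.GenericWeilPeriod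
  haveI : Finite (weilFreeIndex 4) := by unfold weilFreeIndex; infer_instance
  obtain ⟨y, hy, hsmall⟩ :=
    exists_algebraicIndependent_real_small (weilFreeIndex 4) (δ := 1 / 16) (by norm_num)
  obtain ⟨E, hEt, hEb, hEJ, hfree⟩ := exists_perturbation y hsmall
  refine ⟨1 + E, ?_, ?_, ?_⟩
  · exact posDef_one_add hEt hEb
  · rw [add_mul, mul_add, one_mul, mul_one, hEJ]
  · -- the free entries are `y_{ab} + 1_{a = b}`: an affine image of `y`
    unfold IsWeilGeneric
    have h := algebraicIndependent_affine hy (fun _ => 1)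
      (fun ab => if ab.1.1 = ab.1.2 then 1 else 0) (fun _ => one_ne_zero)
    convert h using 1
    funext ab
    exact hfree ab

end Summit.HodgeConjecture.HodgeConjecture.Theorems

end
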